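import Mathlib
import Summits.Ventures.FusionMHD.Models.SAlphaStableS3A175M7Defs
import HarnessLib

/-!
# STABLE-POINT core at `(3, 7/4)`, piece 0 (`[0, 1/2]`): kernel-decided Taylor-model leaves ⇒ `F_0 > 0` and `amplitudeResidual 3 (7/4) F_0 F_0″ ≤ 0` on the piece ⇒ `EnergyDominatesOn` for its amplitude phase

LADDER-GRIDFUSION rung F3 («F3.BALLOON-sα-S3-A175-STABLE-SIDE»: the SECOND halving at s = 3 ([8/5, 19/10] → [7/4, 19/10])); gridfusion-model-7 g9, 2026-08-28 (g8's core lane).  Two `decide +kernel` calls (`OpModel.trig.pLeavesCheck`, scale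
`2^60`, Taylor degree 10, 8 leaves of half-width 1/32) and the lane's soundness theorem `OpSem.trig.pos_of_pLeavesCheck`
(Literature/Analysis/ValidatedNumerics/TaylorModelZeroCert); lit-4's `energyDominatesOn_of_amplitude` (BallooningSAlphaStableSide) turns the two
sign facts into energy domination by `amplitudePhase 3 (7/4) F_0 F_0′` on the piece.  MODELLED: `s–α` model; nothing about a device.
No `native_decide`.  Citations: Freidberg 2014 §12.6.2 (12.97) [Freidberg2014]; Makino–Berz 2003 Alg. 2 [MakinoBerz2003]; Hartman 2002 XI.6.2
[Hartman2002].  Everything here is [instance data].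
-/

open Literature.Analysis.ValidatedNumerics Literature.Analysis.ValidatedNumerics.PolyMP
open Literature.Analysis.ValidatedNumerics.NumericsMP Literature.Analysis.ValidatedNumerics.ExpPoly
open Literature.MathematicalPhysics.MHD.Ballooning
open Real Set

namespace Summit.Ventures.FusionMHD.Models

namespace SAlphaStableS3A175M7

/-- SEMANTICS OF THE PROGRAM: the top register of `st3175Prog lf lf2` is `−amplitudeResidual 3 (7/4) (Poly.eval lf) (Poly.eval lf2)`.
[instance data] -/
theorem toFunP_st3175Prog (lf lf2 : Poly) (t : ℝ) :
    TProg.toFunP (st3175Prog lf lf2) [] t = -SAlpha.amplitudeResidual 3 (7 / 4) (Poly.eval lf) (Poly.eval lf2) t := by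
  unfold SAlpha.amplitudeResidual SAlpha.bending SAlpha.shearParam SAlpha.localShear
  simp [st3175Prog, TProg.toFunP, constStack, TProg.runF, TOp.evalF, SOp.evalF, getReg]
  ring

/-- Semantics of `st3175PosProg`. [instance data] -/
theorem toFunP_st3175PosProg (lf : Poly) (t : ℝ) : TProg.toFunP (st3175PosProg lf) [] t = Poly.eval lf t := by
  simp [st3175PosProg, TProg.toFunP, constStack, TProg.runF, TOp.evalF, SOp.evalF]

/-- From a kernel-accepted leaf tiling of `[x, y]` for `st3175Prog`: the amplitude residual is `≤ 0` on `[x, y]`. [instance data] -/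
theorem st3175_residual_nonpos {lf lf2 : Poly} {L : List PLeaf} {x y : ℚ} (hxy : x < y)
    (ht : tiles x (L.map fun l => (l.e, l.k)) y = true)
    (hc : OpModel.trig.pLeavesCheck st3175Prm (2 ^ 60) (st3175Prog lf lf2) [] L = true)
    {t : ℝ} (h1 : (x : ℝ) ≤ t) (h2 : t ≤ (y : ℝ)) :
    SAlpha.amplitudeResidual 3 (7 / 4) (Poly.eval lf) (Poly.eval lf2) t ≤ 0 := by
  obtain ⟨-, h⟩ := OpSem.trig.pos_of_pLeavesCheck (prm := st3175Prm) (S := 2 ^ 60) (by norm_num) boxMem_nil L x y ht hc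
  have h' := h hxy t ⟨h1, h2⟩
  rw [toFunP_trig, toFunP_st3175Prog] at h'
  linarith

/-- From a kernel-accepted leaf tiling of `[x, y]` for `st3175PosProg`: `F > 0` on `[x, y]`. [instance data] -/
theorem st3175_pos {lf : Poly} {L : List PLeaf} {x y : ℚ} (hxy : x < y)
    (ht : tiles x (L.map fun l => (l.e, l.k)) y = true)
    (hc : OpModel.trig.pLeavesCheck st3175Prm (2 ^ 60) (st3175PosProg lf) [] L = true)
    {t : ℝ} (h1 : (x : ℝ) ≤ t) (h2 : t ≤ (y : ℝ)) : 0 < Poly.eval lf t := by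
  obtain ⟨-, h⟩ := OpSem.trig.pos_of_pLeavesCheck (prm := st3175Prm) (S := 2 ^ 60) (by norm_num) boxMem_nil L x y ht hc
  have h' := h hxy t ⟨h1, h2⟩
  rwa [toFunP_trig, toFunP_st3175PosProg] at h'

/-- Energy domination on a piece `[x, y]` from the two leaf certificates of a polynomial amplitude. [instance data] -/
theorem st3175_dominates {lf : Poly} {L : List PLeaf} {x y : ℚ} (hxy : x < y)
    (ht : tiles x (L.map fun l => (l.e, l.k)) y = true)
    (hres : OpModel.trig.pLeavesCheck st3175Prm (2 ^ 60) (st3175Prog lf (Poly.deriv (Poly.deriv lf))) [] L = true)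
    (hpos : OpModel.trig.pLeavesCheck st3175Prm (2 ^ 60) (st3175PosProg lf) [] L = true) :
    SAlpha.EnergyDominatesOn 3 (7 / 4) (SAlpha.amplitudePhase 3 (7 / 4) (Poly.eval lf) (Poly.eval (Poly.deriv lf)))
      (Icc (x : ℝ) (y : ℝ)) :=
  SAlpha.energyDominatesOn_of_amplitude (F'' := Poly.eval (Poly.deriv (Poly.deriv lf)))
    (fun θ _ => Poly.hasDerivAt_eval lf θ) (fun θ _ => Poly.hasDerivAt_eval (Poly.deriv lf) θ)
    (Poly.continuous_eval _).continuousOn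
    (fun _ hθ => st3175_pos hxy ht hpos hθ.1 hθ.2)
    (fun _ hθ => st3175_residual_nonpos hxy ht hres hθ.1 hθ.2)

/-- KERNEL CHECK (residual leaves of piece 0). [instance data] -/
theorem st3175_res0_ok : OpModel.trig.pLeavesCheck st3175Prm (2 ^ 60) (st3175Prog K0 (Poly.deriv (Poly.deriv K0))) [] st3175Leaves0 = true := by
  decide +kernel

/-- KERNEL CHECK (positivity leaves of piece 0). [instance data] -/
theorem st3175_pos0_ok : OpModel.trig.pLeavesCheck st3175Prm (2 ^ 60) (st3175PosProg K0) [] st3175Leaves0 = true := by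
  decide +kernel

/-- The leaves tile `[0, 1/2]`. [instance data] -/
theorem st3175_tiles0 : tiles (0 : ℚ) (st3175Leaves0.map fun l => (l.e, l.k)) (1/2 : ℚ) = true := by
  decide +kernel

/-- **PIECE 0**: the phase of `F_0` dominates the `s–α` energy on `[0, 1/2]` at `(s, α) = (3, 7/4)`. [instance data] -/
theorem st3175_dominates0 :
    SAlpha.EnergyDominatesOn 3 (7 / 4) (SAlpha.amplitudePhase 3 (7 / 4) (Poly.eval K0) (Poly.eval (Poly.deriv K0)))
      (Icc (0 : ℝ) (1/2 : ℝ)) := by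
  have h := st3175_dominates (lf := K0) (x := 0) (y := 1/2) (by norm_num) st3175_tiles0 st3175_res0_ok st3175_pos0_ok
  norm_num at h
  exact h

end SAlphaStableS3A175M7

end Summit.Ventures.FusionMHD.Models
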